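import Summits.QuantumFields.YangMills.Theorems.HyperbolicRegulatorCurvatureAnchorRDefsB
import Summits.QuantumFields.YangMills.Theorems.HyperbolicRegulatorCurvatureAnchorRStubCt
import Summits.QuantumFields.YangMills.Theorems.HyperbolicRegulatorCurvatureAnchorRStubKunneth
import Summits.QuantumFields.YangMills.Theorems.HyperbolicRegulatorCurvatureAnchorRStubInstantiate

/-!
# Route `HyperbolicRegulator`, crux `CurvatureAnchorR` (stmt-QuantumFields-18155): the reduction of line `witten_hessian`

Lead `prover-line-stmt-QuantumFields-18155-0`, after wave 1 of the line.  The registered skeleton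
`Cruxes/CurvatureAnchorR/Lines/witten_hessian.lean` composes five stubs into the crux BY NAME; three of them are now
landed theorems —

* `stub_ct : CombesThomasSqrt` (`…StubCt`, p173035: the finite-matrix Combes–Thomas lemma with the square-root rate),
* `stub_kunneth : SqCx → Poinc k → Coh → DualPoinc k → KunnethGap k` (`…StubKunneth`, p174031, with `…StubKunnethFactor`
  p173755 and `…StubKunnethHodge` p173877: the Künneth–Poincaré gap of the 1-form Hodge Laplacian of `S × S`),
* `stub_instantiate` (`…StubInstantiate`, p173947, with `…StubInstantiateHelpers` p173616: contractible-support mixing for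
  `j ≥ k` ⇒ the crux's chart-read clustering functional),

and the remaining two are the named hypotheses `TowersHyp` (= `stub_towers`, log-girth expander square towers; crux-sized,
see `Cruxes/CurvatureAnchorR/Lines/witten_hessian-stub_towers-assessment.md`) and `MixingHyp` (= `stub_mixing`, the open
analytic core) of `…DefsB`.  This file records, sorry-free, what the line has reduced the crux to:

    TowersHyp → MixingHyp → CurvatureAnchorR.

It is the glue a planner needs to split the crux into the two items `ExpanderSquareTowers` (`TowersHyp`) and
`AnchorGivenTowers` (`MixingHyp`) (`ledger route edit … --split CurvatureAnchorR … --glue-by CurvatureAnchorR_of_hyps`),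
and it is what closes the crux by one line once both land.  Nothing else is claimed; in particular the crux itself is NOT
proved here (both hypotheses are open).
-/

set_option autoImplicit false

noncomputable section

namespace Summit.QuantumFields.YangMills.Cruxes.CurvatureAnchorR.WittenHessian

open Literature.MathematicalPhysics.QuantumFieldTheory Literature.MathematicalPhysics.QuantumLattice
open Summit.QuantumFields.YangMills.Theses.HyperbolicRegulator

/-- **The reduction achieved by line `witten_hessian`.**  The crux `CurvatureAnchorR` follows from the two named
hypotheses `TowersHyp` (log-girth expander square towers) and `MixingHyp` (contractible-support exponential mixing at giant
`β`, `j`-uniform), by the registered composition with the three landed stubs: the family and `C_T` come from `TowersHyp`;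
admissibility is the crux's first conjunct by `rfl`; `stub_kunneth` turns clauses 1–3, 7 of `AdmR` + `Coh` + `DualPoinc`
into `KunnethGap` at every `(k, j)`; `MixingHyp`, fed `stub_ct`, the family, its admissibility, its diameter-dominated
tameness and the Künneth gaps, gives `c` and, per `k ≥ 8`, `β₀(k)` and per `β ≥ β₀(k)` the `j`-uniform mixing constant;
`stub_instantiate` turns that into the crux's clustering functional for every pair of `YMSpecies` of support radius
`≤ ⌊k/8⌋`.  The type is literally the route's crux. -/
theorem CurvatureAnchorR_of_hyps (hT : TowersHyp) (hM : MixingHyp) :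
    Summit.QuantumFields.YangMills.Theses.HyperbolicRegulator.CurvatureAnchorR := by
  intro G _ _ _ _ hG r
  obtain ⟨CT, V, E, Q, σ, τ, bd, cV, cE, h⟩ := hT
  have hAdm : ∀ k j : ℕ, 8 ≤ k → AdmR k j (V k j) (E k j) (Q k j) (σ k j) (τ k j) (bd k j) (cV k j) (cE k j) :=
    fun k j hk => (h k j hk).1
  have hKun : ∀ k j : ℕ, 8 ≤ k → KunnethGap k (V k j) (E k j) (Q k j) (σ k j) (τ k j) (bd k j) := fun k j hk => by
    obtain ⟨⟨h1, h2, h3, -, -, -, h7, -⟩, -, hC, hD⟩ := h k j hk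
    exact stub_kunneth k (V k j) (E k j) (Q k j) (σ k j) (τ k j) (bd k j) ⟨h1, h2, h3⟩ h7 hC hD
  obtain ⟨c, hc, hmix⟩ := hM G hG r stub_ct CT V E Q σ τ bd cV cE hAdm (fun k j hk => (h k j hk).2.1) hKun
  refine ⟨V, E, Q, σ, τ, bd, cV, cE, hAdm, c, hc, fun k hk => ?_⟩
  obtain ⟨β₀, hβ₀⟩ := hmix k hk
  refine ⟨β₀, fun β hβ A B hA hB => ?_⟩
  obtain ⟨Kc, hKc⟩ := hβ₀ β hβ
  exact stub_instantiate G hG r V E Q σ τ bd cV cE hAdm c k β Kc hc hk hKc A B hA hB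

end Summit.QuantumFields.YangMills.Cruxes.CurvatureAnchorR.WittenHessian

end
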